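import Summits.CriticalPhenomena.PercolationContinuityZ3.Theorems.Transplant.SkelFrmQuasiBParamsFaceCountsYA
import Summits.CriticalPhenomena.PercolationContinuityZ3.Theorems.Transplant.SkelFrmBParamsFaceCountsYA
import Summits.CriticalPhenomena.PercolationContinuityZ3.Theorems.Transplant.SkelFrmQuasiBParamsFaceFloorsZYA
import Summits.CriticalPhenomena.PercolationContinuityZ3.Theorems.Transplant.SkelFrmBParamsFaceFloorsZYA
import Summits.CriticalPhenomena.PercolationContinuityZ3.Theorems.Transplant.PlanarSkeletonFrmQuasiDefs
import Summits.CriticalPhenomena.PercolationContinuityZ3.Theorems.Transplant.PlanarSkeletonFrmDefs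
import Summits.CriticalPhenomena.PercolationContinuityZ3.Theorems.Transplant.SkelPhiStepIDataNS
import Summits.CriticalPhenomena.PercolationContinuityZ3.Theorems.Transplant.SkelNegBParamsFaceCountsRangeYA
import HarnessLib
import Summits.CriticalPhenomena.PercolationContinuityZ3.Theorems.Transplant.SkelFrmBParamsFaceCountsRangeYA
/-!
# GEN-Q PORT (WAVE-Q table v0.8 section 2, row G153, U-level L17; captain R-6/R-7 2026-08-27: carrier token swap `PlanarSkeletonFrmFrom ↦ PlanarSkeletonFrmQuasi`)
# of the tree module «Transplant/SkelFrmFromBParamsFaceCountsRangeYA» (sha256 e58aca19c7c3fbc6…) onto the quasi-step carrier `PlanarSkeletonFrmQuasi` (p507026): «SkelFrmQuasiBParamsFaceCountsRangeYA»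

ORIGINAL TITLE: (F) VALUE LAYER, N2 twin (hp-8 g42, 2026-08-23; F-DISCHARGE-MAP-N2 G18 y′-face counts in range, (Δ1)/(R-22)): N1 `SkelNegBParamsFaceCountsRangeYA` (hp-8 g36) over

builds on p205010 (kernel theorem, internal audit signed; external expert review pending) — nothing in this file uses p205010; NOTHING is claimed about any open node
((N3-b), the end state).  Lane `prim-bschramm`, seat `prim-bschramm-stmt` (gen 33; GEN-Q column pen; tool = captain gen-1 g4's port_genq.py R-14 --cone + p3-g30's T1 patch).  Helper file (`--supports stmt-CriticalPhenomena-4575 --as helper`).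
PORT RULES (U-wave r1–r4 re-used, GEN-Q hunk classes of p3-g29 #6136): declaration order, names and proof texts are those of «SkelFrmFromBParamsFaceCountsRangeYA», byte-identical except
(i) the carrier token `PlanarSkeletonFrmFrom ↦ PlanarSkeletonFrmQuasi` in binders, `namespace`/`end` lines and qualified names (module names `SkelFrmFrom… ↦ SkelFrmQuasi…`
in imports of already-ported rows); (ii) `Φ.step ↦ Φ.qstep` with the called Steps lemma replaced by its `…Q`/`_q` twin and the cost `Φ.M` threaded (none in this file unless
listed below); (iii) `Φ.cyl_connected ↦ Φ.cyl_reach` readers (none unless listed); (iv) graph-ball radii / window floors ×`Φ.M` (none unless listed).  Carrier-free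
residents stay imported/exported from the original «SkelFrmBParamsFaceCountsRangeYA» exactly as in the FrmFrom port.  Docstrings and citations are the original's.

-/

noncomputable section

open scoped Classical

namespace Summit.CriticalPhenomena.PercolationContinuityZ3.Theorems.Transplant

namespace PlanarSkeletonFrmQuasi

namespace NegB

open Literature.Probability.Percolation Literature.Probability.LatticeModels SimpleGraph
open Literature.Probability.Percolation.KozmaNitzan.Cells (oth sgOf sgOf_sign)
open SkelConc (Consts)
open Skelφ.StepI (DataN)
open Neg

namespace KS

section RangesY

/-- **The along target of the y′-run is ahead of the landing origin and bounded**: `5r₁ + 1 − E − C ≤ σ·(T1Y − F1cA yL) ≤ 15r₁ − 10u₁ + 1 + E + C`.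
[folklore] -/
theorem along_target_bounds₁ (κ : Consts) {V : Type} [DecidableEq V] [Countable V] {G : SimpleGraph V} [G.LocallyFinite] (Φ : PlanarSkeletonFrmQuasi G) (t : V) (p : unitInterval) (D : Skelφ.StepI.DataNS V) (g : ℕ) (f : ℕ) (P : PCells2T) (hP : P.toPCells2 = fcellsA κ Φ t p D g f) (x : Site 2) (du : MDir) (hd : du.1 = 1) (z : Site 2) {j E : ℕ} (hj : j < P.K)
    (hlev1 : P.faceL 1 j - E ≤ P.lev du x z)
    (hlev2 : P.lev du x z ≤ P.faceL 1 j + E)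
    (yL : Site 2) {C : ℤ} (he : |F1cA κ Φ t p D g f yL| ≤ C) :
    5 * (P.r 1 : ℤ) + 1 - E - C ≤ sgOf du * (T1Y P x du z - F1cA κ Φ t p D g f yL) ∧
      sgOf du * (T1Y P x du z - F1cA κ Φ t p D g f yL) ≤ 15 * (P.r 1 : ℤ) - 10 * u₁A κ Φ t p D g f + 1 + E + C := by
  have hT := T1Y_eq P x du hd z
  obtain ⟨f1, f2⟩ := faceL_bounds₁ κ Φ t p D g f P hP j hj
  have hσ : sgOf du = 1 ∨ sgOf du = -1 := sgOf_sign du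
  obtain ⟨e1, e2⟩ := abs_le.1 he
  set F := F1cA κ Φ t p D g f yL
  have hσF : |sgOf du * F| ≤ C := by rcases hσ with h | h <;> simp [h, abs_le] <;> constructor <;> linarith
  obtain ⟨s1, s2⟩ := abs_le.1 hσF
  rw [mul_sub, hT]
  constructor <;> linarith

/-- **THE ALONG COUNT OF THE y′-RUN IS IN RANGE**: the target is at least one region ahead (the precondition of `NrY_spec`) and `NrY + 1 ≤ 600·Kq`,
whenever `E + C ≤ 8·u₁`. [cite: KozmaNitzan2024, §4 Lemma 11 (p. 22)] -/
theorem NrY_range (κ : Consts) {V : Type} [DecidableEq V] [Countable V] {G : SimpleGraph V} [G.LocallyFinite] (Φ : PlanarSkeletonFrmQuasi G) (t : V) (p : unitInterval) (D : Skelφ.StepI.DataNS V) (g : ℕ) (f : ℕ) (P : PCells2T) (hP : P.toPCells2 = fcellsA κ Φ t p D g f) (x : Site 2) (du : MDir) (hd : du.1 = 1) (z : Site 2) {j E : ℕ} (hj : j < P.K)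
    (hlev1 : P.faceL 1 j - E ≤ P.lev du x z)
    (hlev2 : P.lev du x z ≤ P.faceL 1 j + E)
    (yL : Site 2) {C : ℤ} (he : |F1cA κ Φ t p D g f yL| ≤ C) (hEC : (E : ℤ) + C ≤ 8 * u₁A κ Φ t p D g f) :
    u₁A κ Φ t p D g f ≤ sgOf du * (T1Y P x du z - F1cA κ Φ t p D g f yL) ∧
      NrY κ Φ t p D g f P yL x du z + 1 ≤ 600 * Neg.Kq κ := by
  obtain ⟨a1, a2⟩ := along_target_bounds₁ κ Φ t p D g f P hP x du hd z hj hlev1 hlev2 yL he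
  have hu : 1 ≤ u₁A κ Φ t p D g f := (units_eqA κ Φ t p D g f).2.2.2.2.2
  have hr : (P.r 1 : ℤ) = 40 * (Neg.Kq κ : ℤ) * u₁A κ Φ t p D g f := by rw [(cells_of_hP κ Φ t p D g f P hP).1 1]; exact (units_eqA κ Φ t p D g f).2.2.2.1
  have hq : (1 : ℤ) ≤ Neg.Kq κ := by exact_mod_cast Neg.one_le_Kq κ
  have hC0 : 0 ≤ C := le_trans (abs_nonneg _) he
  set u := u₁A κ Φ t p D g f
  set Q := (Neg.Kq κ : ℤ)
  have hQu : u ≤ Q * u := by nlinarith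
  have hX : u ≤ sgOf du * (T1Y P x du z - F1cA κ Φ t p D g f yL) := by nlinarith
  refine ⟨hX, ?_⟩
  obtain ⟨-, r2⟩ := NrY_spec κ Φ t p D g f P yL x du z hX
  have h1 : u * ((NrY κ Φ t p D g f P yL x du z : ℤ) + 1) ≤ u * (600 * Q) := by nlinarith
  have h2 : ((NrY κ Φ t p D g f P yL x du z : ℤ) + 1) ≤ 600 * Q := le_of_mul_le_mul_left h1 (by linarith)
  have h3 : ((NrY κ Φ t p D g f P yL x du z + 1 : ℕ) : ℤ) ≤ ((600 * Neg.Kq κ : ℕ) : ℤ) := by push_cast; exact h2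
  exact_mod_cast h3

-- GEN-Q (R-2, captain 2026-08-27): `PlanarSkeletonFrmFrom.NegB.KS.N3Y_range` is not in the used cone of the node top — not ported.

/-- **THE ALONG COUNT OF THE y′-RUN IS AT LEAST `200·Kq − 8`** (`5r₁ = 200·Kq·u₁` ahead, the origin within `E + C ≤ 7u₁`, the run ends within one
region of the target). [folklore] -/
theorem clr_NrY_lb (κ : Consts) {V : Type} [DecidableEq V] [Countable V] {G : SimpleGraph V} [G.LocallyFinite] (Φ : PlanarSkeletonFrmQuasi G) (t : V) (p : unitInterval) (D : Skelφ.StepI.DataNS V) (g : ℕ) (f : ℕ) (P : PCells2T) (hP : P.toPCells2 = fcellsA κ Φ t p D g f) (x : Site 2) (du : MDir) (hd : du.1 = 1) (z : Site 2) {j E : ℕ} (hj : j < P.K)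
    (hlev1 : P.faceL 1 j - E ≤ P.lev du x z)
    (hlev2 : P.lev du x z ≤ P.faceL 1 j + E)
    (yL : Site 2) {C : ℤ} (he : |F1cA κ Φ t p D g f yL| ≤ C) (hEC : (E : ℤ) + C ≤ 7 * u₁A κ Φ t p D g f) :
    200 * (Neg.Kq κ : ℤ) ≤ (NrY κ Φ t p D g f P yL x du z : ℤ) + 8 := by
  obtain ⟨a1, -⟩ := along_target_bounds₁ κ Φ t p D g f P hP x du hd z hj hlev1 hlev2 yL he
  have hu : 1 ≤ u₁A κ Φ t p D g f := (units_eqA κ Φ t p D g f).2.2.2.2.2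
  obtain ⟨hX, -⟩ := NrY_range κ Φ t p D g f P hP x du hd z hj hlev1 hlev2 yL he (by linarith)
  obtain ⟨hf, -⟩ := NrY_spec κ Φ t p D g f P yL x du z hX
  have hr : (P.r 1 : ℤ) = 40 * (Neg.Kq κ : ℤ) * u₁A κ Φ t p D g f := by rw [(cells_of_hP κ Φ t p D g f P hP).1 1]; exact (units_eqA κ Φ t p D g f).2.2.2.1
  have hσ : sgOf du = 1 ∨ sgOf du = -1 := sgOf_sign du
  set u := u₁A κ Φ t p D g f
  set Q : ℤ := (Neg.Kq κ : ℤ)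
  set N : ℤ := (NrY κ Φ t p D g f P yL x du z : ℤ)
  set T := T1Y P x du z
  set F := F1cA κ Φ t p D g f yL
  obtain ⟨hf1, hf2⟩ := abs_le.1 hf
  have key : (200 * Q - 8) * u + 1 ≤ u * (N + 1) := by
    rcases hσ with h | h <;> rw [h] at hf1 hf2 a1 <;> nlinarith
  by_contra hc
  push Not at hc
  have h1 : N + 9 - 200 * Q ≤ 0 := by linarith
  have h2 : u * (N + 9 - 200 * Q) ≤ 0 := mul_nonpos_of_nonneg_of_nonpos (by linarith) h1
  nlinarith

export PlanarSkeletonNeg.NegB.KS (capY_of_ranges)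

end RangesY

end KS

end NegB

end PlanarSkeletonFrmQuasi

end Summit.CriticalPhenomena.PercolationContinuityZ3.Theorems.Transplant

end
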